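import Mathlib
import Summits.AtomisticToContinuum.Crystallization.Theses.HullMinimality

/-!
# The converse hull criterion: Blanc–Lewin crystallization implies periodic windows
(route `HullMinimality`, support item `stmt-AtomisticToContinuum-11780`, decl `HullCriterionConverse`:
`IsCrystallizing lennardJones 3 → PeriodicWindows`)

PROOF. Fix a sequence of Lennard-Jones ground states `x`; `IsCrystallizing` gives a subsequence `φ`,
translations `τ`, a periodic configuration `P` and multiplicities `m ≥ 1` on `P.points` such that
`∑ᵢ f(x (φ j) i + τ j) → ∑' s : P.points, m s * f s` for every continuous compactly supported `f`
(Blanc–Lewin 2015, (16)). Take the same `P` and fix a scale `(R, ε)`, `ε > 0`.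

* Sites → particles. Only finitely many sites lie in the closed ball of radius `R`
  (`PeriodicConfiguration.finite_inter_points`). For each such site `s` test (16) with the cone bump
  of radius `ε` centred at `s`: the limit is `≥ m(s)·ε ≥ ε > 0` (`PeriodicConfiguration.mul_le_tsum`),
  so eventually the finite sum is positive, i.e. some particle `x (φ j) i + τ j` lies within `ε` of
  `s`. A finite intersection of eventual statements is eventual.
* Particles → sites. Test (16) with the single separator
  `g z = min ε (infDist z P.points) · coneBump 0 (R+1) z`: continuous, compactly supported,
  non-negative, vanishing on `P.points`, so the limit is `0` and eventually the sum of the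
  non-negative terms `g (x (φ j) i + τ j)` is `< ε`; each term is then `< ε`, and on the ball of
  radius `R` the cutoff `coneBump 0 (R+1)` is `≥ 1`, whence `infDist (x (φ j) i + τ j) P.points < ε`,
  i.e. some site lies within `ε`.

Both clauses hold eventually along `φ` with the translation `τ j`; since `φ` is strictly increasing
(`StrictMono.tendsto_atTop`), eventually along `φ` implies frequently in `N`.
-/

noncomputable section

namespace Summit.AtomisticToContinuum.Crystallization.Theorems

open Summit.AtomisticToContinuum.Crystallization.Theses
open Literature.MathematicalPhysics.StatisticalMechanics
open Filter Topology Metric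

/-- Sites → particles, one site at a time: if the translated subsequence converges locally to the
point measure `∑ m(s) δ_s` with `m ≥ 1` on `P.points`, then for every site `s` and every `ε > 0`,
eventually some particle lies within `ε` of `s` (test with the cone bump of radius `ε` at `s`). -/
theorem hullConverse_eventually_particle_near
    {x : (N : ℕ) → (Fin N → EuclideanSpace ℝ (Fin 3))} {φ : ℕ → ℕ}
    {τ : ℕ → EuclideanSpace ℝ (Fin 3)} (P : PeriodicConfiguration 3)
    {m : EuclideanSpace ℝ (Fin 3) → ℕ} (hm : ∀ s ∈ P.points, 1 ≤ m s)
    (hlim : ∀ f : EuclideanSpace ℝ (Fin 3) → ℝ, Continuous f → HasCompactSupport f →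
      Tendsto (fun j => ∑ i : Fin (φ j), f (x (φ j) i + τ j)) atTop
        (𝓝 (∑' s : P.points, (m s : ℝ) * f s)))
    {s : EuclideanSpace ℝ (Fin 3)} (hs : s ∈ P.points) {ε : ℝ} (hε : 0 < ε) :
    ∀ᶠ j in atTop, ∃ i : Fin (φ j), dist (x (φ j) i + τ j) s ≤ ε := by
  have hpos : (0 : ℝ) < ∑' s' : P.points, (m s' : ℝ) * coneBump s ε s' := by
    refine lt_of_lt_of_le ?_ (P.mul_le_tsum (coneBump.hasCompactSupport s ε)
      (coneBump.nonneg s ε) m hs)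
    rw [coneBump.apply_self, max_eq_right hε.le]
    have h1 : (1 : ℝ) ≤ m s := by exact_mod_cast hm s hs
    nlinarith
  filter_upwards [(hlim _ (coneBump.continuous s ε) (coneBump.hasCompactSupport s ε)).eventually
    (lt_mem_nhds hpos)] with j hj
  obtain ⟨i, -, hi⟩ := Finset.exists_lt_of_sum_lt
    (by simpa using hj : ∑ _i : Fin (φ j), (0 : ℝ) < ∑ i, coneBump s ε (x (φ j) i + τ j))
  exact ⟨i, (coneBump.dist_lt_of_pos s ε hi).le⟩

/-- Particles → sites: if the translated subsequence converges locally to a point measure carried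
by `P.points`, then for every radius `R` and every `ε > 0`, eventually every particle in the closed
ball of radius `R` lies within `ε` of a site (test with the separator
`z ↦ min ε (infDist z P.points) · coneBump 0 (R+1) z`, which vanishes on `P.points`). -/
theorem hullConverse_eventually_site_near
    {x : (N : ℕ) → (Fin N → EuclideanSpace ℝ (Fin 3))} {φ : ℕ → ℕ}
    {τ : ℕ → EuclideanSpace ℝ (Fin 3)} (P : PeriodicConfiguration 3)
    {m : EuclideanSpace ℝ (Fin 3) → ℕ}
    (hlim : ∀ f : EuclideanSpace ℝ (Fin 3) → ℝ, Continuous f → HasCompactSupport f →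
      Tendsto (fun j => ∑ i : Fin (φ j), f (x (φ j) i + τ j)) atTop
        (𝓝 (∑' s : P.points, (m s : ℝ) * f s)))
    (R : ℝ) {ε : ℝ} (hε : 0 < ε) :
    ∀ᶠ j in atTop, ∀ i : Fin (φ j), ‖x (φ j) i + τ j‖ ≤ R →
      ∃ s ∈ P.points, dist (x (φ j) i + τ j) s ≤ ε := by
  -- the separator
  set g : EuclideanSpace ℝ (Fin 3) → ℝ :=
    fun z => min ε (infDist z P.points) * coneBump 0 (R + 1) z
  have hG : ∀ z, g z = min ε (infDist z P.points) * coneBump 0 (R + 1) z := fun z => rfl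
  have hgc : Continuous g :=
    (continuous_const.min (continuous_infDist_pt _)).mul (coneBump.continuous 0 (R + 1))
  have hgs : HasCompactSupport g :=
    (coneBump.hasCompactSupport (0 : EuclideanSpace ℝ (Fin 3)) (R + 1)).mul_left
  have hg0 : ∀ z, 0 ≤ g z := fun z =>
    mul_nonneg (le_min hε.le infDist_nonneg) (coneBump.nonneg 0 (R + 1) z)
  -- it vanishes on the sites, so the limit is `0`
  have hlim0 : ∑' s : P.points, (m s : ℝ) * g s = 0 := by
    have h : (fun s : P.points => (m s : ℝ) * g s) = fun _ => 0 := funext fun s => by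
      rw [hG, infDist_zero_of_mem s.2, min_eq_right hε.le, zero_mul, mul_zero]
    rw [h, tsum_zero]
  have hev : ∀ᶠ j in atTop, ∑ i : Fin (φ j), g (x (φ j) i + τ j) < ε := by
    have h := hlim g hgc hgs
    rw [hlim0] at h
    exact h.eventually (gt_mem_nhds hε)
  filter_upwards [hev] with j hj i hi
  -- the term at `i` is `< ε`
  have hgi : g (x (φ j) i + τ j) < ε :=
    lt_of_le_of_lt (Finset.single_le_sum (fun k _ => hg0 (x (φ j) k + τ j)) (Finset.mem_univ i)) hj
  -- on the ball of radius `R` the cutoff is `≥ 1`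
  have hcut : 1 ≤ coneBump 0 (R + 1) (x (φ j) i + τ j) := by
    refine le_trans ?_ (coneBump.sub_dist_le 0 (R + 1) _)
    rw [dist_zero_right]
    linarith
  -- hence `infDist < ε`
  have hinf : infDist (x (φ j) i + τ j) P.points < ε := by
    refine not_le.mp fun h => ?_
    have h' : ε ≤ g (x (φ j) i + τ j) := by
      rw [hG, min_eq_left h]
      simpa using mul_le_mul_of_nonneg_left hcut hε.le
    linarith
  obtain ⟨s, hs, hds⟩ := (infDist_lt_iff P.points_nonempty).1 hinf
  exact ⟨s, hs, hds.le⟩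

/-- **`HullCriterionConverse`** (item stmt-AtomisticToContinuum-11780, verbatim): the Blanc–Lewin
crystallization statement `IsCrystallizing lennardJones 3` implies periodic windows at every scale,
frequently in `N` (`PeriodicWindows`), with the same periodic configuration `P`: along the
crystallizing subsequence, cone bumps at the finitely many sites of the ball give the
sites → particles clause and the separator vanishing on `P.points` gives the particles → sites
clause, eventually along `φ`; eventually along a strictly increasing `φ` is frequently in `N`. -/
theorem hullCriterionConverse_proof : HullMinimality.HullCriterionConverse := by
  intro hcr x hx
  obtain ⟨φ, τ, P, m, hφ, hm, -, hlim⟩ := hcr x hx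
  refine ⟨P, fun R ε hε => ?_⟩
  -- sites → particles, eventually along `φ` (finitely many sites in the ball)
  have hfin : (closedBall (0 : EuclideanSpace ℝ (Fin 3)) R ∩ P.points).Finite :=
    P.finite_inter_points isBounded_closedBall
  have h1 : ∀ᶠ j in atTop, ∀ s ∈ closedBall (0 : EuclideanSpace ℝ (Fin 3)) R ∩ P.points,
      ∃ i : Fin (φ j), dist (x (φ j) i + τ j) s ≤ ε :=
    hfin.eventually_all.2 fun s hs => hullConverse_eventually_particle_near P hm hlim hs.2 hε
  -- particles → sites, eventually along `φ`
  have h2 := hullConverse_eventually_site_near P hlim R hε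
  -- eventually along `φ` implies frequently in `N`
  refine hφ.tendsto_atTop.frequently (Eventually.frequently ?_)
  filter_upwards [h1, h2] with j hj1 hj2
  refine ⟨τ j, fun s hs hsR => hj1 s ⟨?_, hs⟩, hj2⟩
  rwa [mem_closedBall, dist_zero_right]

end Summit.AtomisticToContinuum.Crystallization.Theorems

end
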